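/-
Copyright (c) 2026 the pub-hodgecm-mathlib formalisation cell (harness21).  Prover seat hodgecm-mathlib-K2Liu-p12 (g6), Track B «K2-LIT»,
#184♮ = hLiu418 = `stmt-HodgeConjecture-24832`; #42S block D, row D-2, (σ-A) mini-road ((σ-A) road desk K2Liu-p25 (g3) WORD #53∕#54∕#56: brick (B2-coord),
FLAG 4 ruled «(N) — NORMALISED IMPLEMENTER PAIR OF RECORD»).  THEOREMS ONLY (no `def`, no `instance`, no `notation`, no named-fact hypothesis, no `sorry`).
-/
import Summits.HodgeConjecture.HodgeConjecture.Theorems.K2LiuTensorMiddleCellPointReading   -- ★ (C3-c) `halfDiff_eD_symm_apply`, the local doubled package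
import Literature.RepresentationTheory.HeisenbergGroup.SymplecticSiegelGeneration            -- ★ `SymplecticMatrix.levi`, `coe_levi`
import HarnessLib

/-!
# Crux `HLiu418`, #42S block D row D-2, (σ-A) brick (B2-coord) FILE B′ `K2LiuNormalisedCayleyReading`:
# THE NORMALISED CAYLEY MOVER `m(M)·κ` (`M⁻¹ = 2 ⊕ T₀`) READS THE POSITION `x` AS PLAIN QUADRATIC COORDINATES `x_{inl i} + x_{inr i}·δ̂`

Cell `hodgecm-mathlib`, crux item hLiu418 = `stmt-HodgeConjecture-24832`; lane `--supports stmt-HodgeConjecture-24832 --as helper` (count-neutral helper).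

WHY (block-D desk FLAG 4, desk WORD #56).  ★ (C3-c) `K2LiuTensorMiddleCellPointReading.exists_moverReading`∕`exists_pointReading` read the integration point
through a mover `a` (`ℓ_Δ ↦ ℓ_Y`) as `cX x = halfDiff (e_D⁻¹ (a⁻¹ (x, 0))) ∈ (E ⊗ F_v)^n`.  At the BARE Cayley pair `a = transportSp 𝕋 κ` (★
`LocalDoubledWeylElementCayleyMover`: `κ(X₁,X₂;Y₁,Y₂) = (X₁−X₂, ½(Y₁+Y₂); ½(Y₁−Y₂), −(X₁+X₂))`, Darboux `Y ↦ 𝕋Y`, `𝕋 = T₀ ⊕ (−T₀)` along `e₂`) this reading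
is `cX(x)_i = ½·x_{inl i} + (T₀⁻¹x_{inr})_i·δ̂` — PER-COORDINATE imaginary weights, so the cone graph `Zm` of ★ p864562 would not be plain quadratic multiplication
in the box coordinates for any single `d` (FLAG 4).  The desk ruled (N): the implementer pins of record are the NORMALISED pair `â := transportSp 𝕋 (m(M)·κ)`
with the diagonal Siegel–Levi factor `M`, `M⁻¹ = 2·1 ⊕ T₀` along `e₂`.  THIS FILE proves the normalisation does its job, with NO condition on `T₀` beyond
`IsUnit det 𝕋` (the `T₀`'s CANCEL against the Darboux twist):
* §1 plumbing along `e₂` (`reindex_mulVec_comp_symm`, `localGram_gramD_eq`, `cayley_mulVec`, `eq_sumElim_comp_symm`);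
* §2 **`transportSp_levi_mul_cayley_apply_antidiag`**: `â ((x¹ ⊔ −x¹), (x² ⊔ −x²)) = (x, 0)` (`x = x¹ ⊔ x²` along `e₂`), and the inverse form
  **`transportSp_levi_mul_cayley_symm_apply`**: `â⁻¹ (x, 0) = ((x¹ ⊔ −x¹), (x² ⊔ −x²))`;
* §3 **`halfDiff_eD_symm_normalisedMover_symm_apply`** ∕ **`moverReading_eq_of_normalised`**: `halfDiff (e_D⁻¹ (â⁻¹ (x, 0))) i = ι_v(x_{inl i}) + ι_v(x_{inr i})·δ̂`
  — the mover reading `ĉX` of the normalised pair IS the plain `(re, im)`-pairing along `e₂`; hence (★ p865058 `K2LiuQuadraticCoordinateBlockAction.hZm_of_pair_mul`)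
  the cone graph through `ĉX` satisfies ★ p864769's `hZm` VERBATIM at `(eJ, eJ′) := ((i,0) ↦ e₂ (inl i), (i,1) ↦ e₂ (inr i))`, `d := d_v`.
The mover letters of the normalised pair (`ℓ_Δ ↦ ℓ_Y`: ★ `map_transportSp_cayleyMover_deltaLagrangian` + `m(M) ℓ_Y = ℓ_Y`; the Weyl conjugate) are K2Liu-p09's
((B1)∕(B2-read)); the point formula of (B2-coord) FILE B follows from §3 + ★ p865058 + (B2-read).
[cite: Kudla1994, §3 Thm. 3.1] [cite: MoeglinVignerasWaldspurger1987, Chap. 2 II.2] [cite: HarrisKudlaSweet1996, §1 (1.11)]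
HONEST LABEL.  Count-neutral helper; it retires nothing by itself: `HC_CM` is proved only modulo the 7 printed citations (2 remaining named inputs:
hLiu418 = `stmt-HodgeConjecture-24832`, h413 = `stmt-HodgeConjecture-24833`) until rung 0 closes.

## References
* [Kudla1994] S. S. Kudla, *Splitting metaplectic covers of dual reductive pairs*, Israel J. Math. 87 (1994), §3 Thm. 3.1 (the Cayley mover).
* [MoeglinVignerasWaldspurger1987] C. Mœglin, M.-F. Vignéras, J.-L. Waldspurger, LNM 1291 (1987), Chap. 2 II.2 (Siegel–Levi elements).
* [HarrisKudlaSweet1996] M. Harris, S. Kudla, W. J. Sweet, J. AMS 9 (1996), §1 (1.11) (the doubled quadratic coordinates).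
-/

set_option autoImplicit false
set_option linter.dupNamespace false -- the mandated namespace repeats `HodgeConjecture.HodgeConjecture`

noncomputable section

open scoped Matrix
open NumberField IsDedekindDomain Matrix
open Literature.RepresentationTheory.HeisenbergGroup Literature.RepresentationTheory.HeisenbergGroup.SymplecticMatrix
open Literature.NumberTheory.Automorphic Literature.NumberTheory.Automorphic.UnitaryGroup Literature.NumberTheory.Weil1964
open Literature.NumberTheory.GelbartRogawski1991 Literature.NumberTheory.GelbartRogawski1991.GRConstruction
open Literature.NumberTheory.GelbartRogawski1991.AdaptedBlocks
open Literature.NumberTheory.GelbartRogawski1991.UnitaryDualPair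
open Literature.NumberTheory.GelbartRogawski1991.UnitaryDualPair.LocalSplitting

namespace Summit.HodgeConjecture.HodgeConjecture.Cruxes.HLiu418.K2LiuNormalisedCayleyReading

variable (F : Type) [Field F] [NumberField F] (v : HeightOneSpectrum (𝓞 F)) (n : ℕ) {T₀ : Matrix (Fin n) (Fin n) F}

/-! ## §1 Matrix plumbing along `e₂` -/

/-- gluing two halves along `e₂` twice is gluing four quarters along `e₂ ⊕ e₂`. [cite: Kudla1994, §3] -/
theorem sumElim_comp_symm_sumElim {α : Type*} (a b c d : Fin n → α) :
    Sum.elim ((Sum.elim a b) ∘ (e₂ n).symm) ((Sum.elim c d) ∘ (e₂ n).symm) =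
      (Sum.elim (Sum.elim a b) (Sum.elim c d)) ∘ ((e₂ n).sumCongr (e₂ n)).symm := by
  funext s
  rcases s with k | k <;> simp

/-- `reindex e e A *ᵥ (w ∘ e⁻¹) = (A *ᵥ w) ∘ e⁻¹`. [cite: Kudla1994, §3] -/
theorem reindex_mulVec_comp_symm {α : Type*} [CommRing α] {ι κ : Type*} [Fintype ι] [Fintype κ] (e : ι ≃ κ) (A : Matrix ι ι α) (w : ι → α) :
    Matrix.reindex e e A *ᵥ (w ∘ e.symm) = (A *ᵥ w) ∘ e.symm := by
  rw [Matrix.reindex_apply, Matrix.submatrix_mulVec_equiv]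
  congr 2
  funext i
  simp

/-- the doubled Gram matrix over `F_v` in block form: `𝕋 = T₀ ⊕ (−T₀)` along `e₂`. [cite: HarrisKudlaSweet1996, §1 (1.9)] -/
theorem localGram_gramD_eq :
    localGram F (n + n) (LocalSplitting.gramD F n T₀) v =
      Matrix.reindex (e₂ n) (e₂ n) (Matrix.fromBlocks (localGram F n T₀ v) 0 0 (-(localGram F n T₀ v))) := by
  ext i j
  simp only [localGram, Matrix.reindex_apply, Matrix.submatrix_apply, Matrix.map_apply]
  rcases (e₂ n).symm i with a | a <;> rcases (e₂ n).symm j with b | b <;> simp [Matrix.map_apply]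

/-- the Cayley matrix on a block vector: `κ(X₁,X₂;Y₁,Y₂) = (X₁−X₂, ½(Y₁+Y₂); ½(Y₁−Y₂), −(X₁+X₂))`. [cite: Kudla1994, §3] -/
theorem cayley_mulVec [Invertible (2 : v.adicCompletion F)] (X₁ X₂ Y₁ Y₂ : Fin n → v.adicCompletion F) :
    (Matrix.fromBlocks (Matrix.fromBlocks 1 (-1) 0 0) (Matrix.fromBlocks 0 0 ((⅟(2 : v.adicCompletion F)) • 1) ((⅟(2 : v.adicCompletion F)) • 1))
        (Matrix.fromBlocks 0 0 (-1) (-1)) (Matrix.fromBlocks ((⅟(2 : v.adicCompletion F)) • 1) (-((⅟(2 : v.adicCompletion F)) • 1)) 0 0) :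
      Matrix ((Fin n ⊕ Fin n) ⊕ (Fin n ⊕ Fin n)) ((Fin n ⊕ Fin n) ⊕ (Fin n ⊕ Fin n)) (v.adicCompletion F)) *ᵥ
        Sum.elim (Sum.elim X₁ X₂) (Sum.elim Y₁ Y₂) =
      Sum.elim (Sum.elim (X₁ - X₂) ((⅟(2 : v.adicCompletion F)) • (Y₁ + Y₂)))
        (Sum.elim ((⅟(2 : v.adicCompletion F)) • (Y₁ - Y₂)) (-(X₁ + X₂))) := by
  simp only [Matrix.fromBlocks_mulVec, Sum.elim_comp_inl, Sum.elim_comp_inr, Matrix.one_mulVec, Matrix.neg_mulVec, Matrix.zero_mulVec,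
    Matrix.smul_mulVec, add_zero]
  funext s
  rcases s with (i | i) | (i | i) <;> simp <;> ring


/-- a vector of `F_v^{n+n}` is the gluing of its two `e₂`-halves. [cite: Kudla1994, §3] -/
theorem eq_sumElim_comp_symm {α : Type*} (x : Fin (n + n) → α) :
    x = (Sum.elim (fun i => x (e₂ n (Sum.inl i))) (fun i => x (e₂ n (Sum.inr i)))) ∘ (e₂ n).symm := by
  funext k
  obtain ⟨s, rfl⟩ := (e₂ n).surjective k
  rcases s with i | i <;> simp only [Function.comp_apply, Equiv.symm_apply_apply, Sum.elim_inl, Sum.elim_inr]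

/-! ## §2 The NORMALISED Cayley mover `m(M)·κ` (`M⁻¹ = 2 ⊕ T₀` along `e₂`): it sends the anti-diagonal point
`((x¹, −x¹), (x², −x²))` to `(x, 0)` -/

/-- **THE NORMALISED CAYLEY MOVER ON THE ANTI-DIAGONAL**: with `κ` the Cayley matrix (★ `doublingCayley`, re-indexed by `e₂ ⊕ e₂`), `M ∈ GL_{n+n}(F_v)`
with `M⁻¹ = 2·1 ⊕ T₀` along `e₂`, and `Â := m(M)·κ`, the transported element `transportSp 𝕋 Â` maps `((x¹ ⊔ −x¹), (x² ⊔ −x²)) ↦ (x, 0)`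
(`x = x¹ ⊔ x²` along `e₂`): Darboux `Y ↦ 𝕋Y` turns `(x², −x²)` into `(T₀x², T₀x²)`, `κ` gives `(2x¹, T₀x²; 0, 0)`, `m(M)` gives `(x; 0)`.
[cite: Kudla1994, §3] [cite: MoeglinVignerasWaldspurger1987, Chap. 2 II.2] -/
theorem transportSp_levi_mul_cayley_apply_antidiag [Invertible (2 : v.adicCompletion F)]
    (hTv : IsUnit (localGram F (n + n) (LocalSplitting.gramD F n T₀) v).det)
    (K : Matrix.symplecticGroup (Fin (n + n)) (v.adicCompletion F))
    (hK : (K : Matrix (Fin (n + n) ⊕ Fin (n + n)) (Fin (n + n) ⊕ Fin (n + n)) (v.adicCompletion F)) =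
      Matrix.reindex ((e₂ n).sumCongr (e₂ n)) ((e₂ n).sumCongr (e₂ n))
        (Matrix.fromBlocks (Matrix.fromBlocks 1 (-1) 0 0)
            (Matrix.fromBlocks 0 0 ((⅟(2 : v.adicCompletion F)) • 1) ((⅟(2 : v.adicCompletion F)) • 1))
            (Matrix.fromBlocks 0 0 (-1) (-1)) (Matrix.fromBlocks ((⅟(2 : v.adicCompletion F)) • 1) (-((⅟(2 : v.adicCompletion F)) • 1)) 0 0) :
          Matrix ((Fin n ⊕ Fin n) ⊕ (Fin n ⊕ Fin n)) ((Fin n ⊕ Fin n) ⊕ (Fin n ⊕ Fin n)) (v.adicCompletion F)))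
    (M : GL (Fin (n + n)) (v.adicCompletion F))
    (hMinv : ((M⁻¹ : GL (Fin (n + n)) (v.adicCompletion F)) : Matrix (Fin (n + n)) (Fin (n + n)) (v.adicCompletion F)) =
      Matrix.reindex (e₂ n) (e₂ n) (Matrix.fromBlocks ((2 : v.adicCompletion F) • 1) 0 0 (localGram F n T₀ v)))
    (x : Fin (n + n) → v.adicCompletion F) :
    ((transportSp (localGram F (n + n) (LocalSplitting.gramD F n T₀) v) hTv (levi M * K) : LocalSp F (n + n) (LocalSplitting.gramD F n T₀) v) :
        ((Fin (n + n) → v.adicCompletion F) × (Fin (n + n) → v.adicCompletion F)) ≃ₗ[v.adicCompletion F]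
          ((Fin (n + n) → v.adicCompletion F) × (Fin (n + n) → v.adicCompletion F)))
      ((Sum.elim (fun i => x (e₂ n (Sum.inl i))) (fun i => -x (e₂ n (Sum.inl i)))) ∘ (e₂ n).symm,
        (Sum.elim (fun i => x (e₂ n (Sum.inr i))) (fun i => -x (e₂ n (Sum.inr i)))) ∘ (e₂ n).symm) = (x, 0) := by
  rw [coe_transportSp_apply, SymplecticMatrix.darboux_apply]
  dsimp only
  -- the Darboux `Y`-coordinate of the anti-diagonal point: `𝕋 (x² ⊔ −x²) = (T₀x² ⊔ T₀x²)`
  have hY : localGram F (n + n) (LocalSplitting.gramD F n T₀) v *ᵥ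
        ((Sum.elim (fun i => x (e₂ n (Sum.inr i))) (fun i => -x (e₂ n (Sum.inr i)))) ∘ (e₂ n).symm) =
      (Sum.elim (localGram F n T₀ v *ᵥ fun i => x (e₂ n (Sum.inr i))) (localGram F n T₀ v *ᵥ fun i => x (e₂ n (Sum.inr i)))) ∘
        (e₂ n).symm := by
    rw [localGram_gramD_eq F v n, reindex_mulVec_comp_symm]
    have hneg : (fun i => -x (e₂ n (Sum.inr i))) = -(fun i => x (e₂ n (Sum.inr i))) := rfl
    rw [Matrix.fromBlocks_mulVec, Sum.elim_comp_inl, Sum.elim_comp_inr, Matrix.zero_mulVec, Matrix.zero_mulVec, add_zero, zero_add, hneg,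
      Matrix.mulVec_neg, Matrix.neg_mulVec, neg_neg]
  rw [hY, sumElim_comp_symm_sumElim, Submonoid.coe_mul, ← Matrix.mulVec_mulVec, hK, reindex_mulVec_comp_symm, cayley_mulVec]
  -- `M⁻¹ x = (2x¹ ⊔ T₀x²)`
  have hx : ((M⁻¹ : GL (Fin (n + n)) (v.adicCompletion F)) : Matrix (Fin (n + n)) (Fin (n + n)) (v.adicCompletion F)) *ᵥ x =
      (Sum.elim ((2 : v.adicCompletion F) • fun i => x (e₂ n (Sum.inl i))) (localGram F n T₀ v *ᵥ fun i => x (e₂ n (Sum.inr i)))) ∘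
        (e₂ n).symm := by
    rw [hMinv]
    conv_lhs => rw [eq_sumElim_comp_symm n x]
    rw [reindex_mulVec_comp_symm, Matrix.fromBlocks_mulVec, Sum.elim_comp_inl, Sum.elim_comp_inr, Matrix.zero_mulVec, Matrix.zero_mulVec,
      add_zero, zero_add, Matrix.smul_mulVec, Matrix.one_mulVec]
  -- the Cayley image is `(M⁻¹ x; 0)`
  have h2 : (Sum.elim
        (Sum.elim ((fun i => x (e₂ n (Sum.inl i))) - fun i => -x (e₂ n (Sum.inl i)))
          (⅟(2 : v.adicCompletion F) • ((localGram F n T₀ v *ᵥ fun i => x (e₂ n (Sum.inr i))) + localGram F n T₀ v *ᵥ fun i => x (e₂ n (Sum.inr i)))))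
        (Sum.elim
          (⅟(2 : v.adicCompletion F) • ((localGram F n T₀ v *ᵥ fun i => x (e₂ n (Sum.inr i))) - localGram F n T₀ v *ᵥ fun i => x (e₂ n (Sum.inr i))))
          (-((fun i => x (e₂ n (Sum.inl i))) + fun i => -x (e₂ n (Sum.inl i)))))) ∘ ((e₂ n).sumCongr (e₂ n)).symm =
      Sum.elim (((M⁻¹ : GL (Fin (n + n)) (v.adicCompletion F)) : Matrix (Fin (n + n)) (Fin (n + n)) (v.adicCompletion F)) *ᵥ x) 0 := by
    funext k
    rcases k with k | k
    · obtain ⟨s, rfl⟩ := (e₂ n).surjective k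
      rw [Sum.elim_inl, hx]
      rcases s with i | i
      · simp only [Function.comp_apply, Equiv.sumCongr_symm, Equiv.sumCongr_apply, Sum.map_inl, Equiv.symm_apply_apply, Sum.elim_inl,
          Pi.sub_apply, Pi.smul_apply, smul_eq_mul]
        ring
      · simp only [Function.comp_apply, Equiv.sumCongr_symm, Equiv.sumCongr_apply, Sum.map_inl, Equiv.symm_apply_apply, Sum.elim_inl,
          Sum.elim_inr, Pi.smul_apply, Pi.add_apply, smul_eq_mul]
        rw [← two_mul, ← mul_assoc, invOf_mul_self, one_mul]
    · obtain ⟨s, rfl⟩ := (e₂ n).surjective k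
      rw [Sum.elim_inr, Pi.zero_apply]
      rcases s with i | i
      · simp only [Function.comp_apply, Equiv.sumCongr_symm, Equiv.sumCongr_apply, Sum.map_inr, Equiv.symm_apply_apply, Sum.elim_inl,
          Sum.elim_inr, sub_self, smul_zero, Pi.zero_apply]
      · simp only [Function.comp_apply, Equiv.sumCongr_symm, Equiv.sumCongr_apply, Sum.map_inr, Equiv.symm_apply_apply, Sum.elim_inr,
          Pi.neg_apply, Pi.add_apply, add_neg_cancel, neg_zero]
  rw [h2, coe_levi, Matrix.fromBlocks_mulVec]
  simp only [Sum.elim_comp_inl, Sum.elim_comp_inr, Matrix.mulVec_zero, Matrix.zero_mulVec, add_zero]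
  rw [Matrix.mulVec_mulVec, ← Units.val_mul, mul_inv_cancel, Units.val_one, Matrix.one_mulVec, SymplecticMatrix.darboux_symm_sumElim,
    Matrix.mulVec_zero]


/-- the inverse form: `(transportSp 𝕋 (m(M)·κ))⁻¹ (x, 0) = ((x¹ ⊔ −x¹), (x² ⊔ −x²))` — the `T₀`'s CANCEL. [cite: Kudla1994, §3] -/
theorem transportSp_levi_mul_cayley_symm_apply [Invertible (2 : v.adicCompletion F)]
    (hTv : IsUnit (localGram F (n + n) (LocalSplitting.gramD F n T₀) v).det)
    (K : Matrix.symplecticGroup (Fin (n + n)) (v.adicCompletion F))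
    (hK : (K : Matrix (Fin (n + n) ⊕ Fin (n + n)) (Fin (n + n) ⊕ Fin (n + n)) (v.adicCompletion F)) =
      Matrix.reindex ((e₂ n).sumCongr (e₂ n)) ((e₂ n).sumCongr (e₂ n))
        (Matrix.fromBlocks (Matrix.fromBlocks 1 (-1) 0 0)
            (Matrix.fromBlocks 0 0 ((⅟(2 : v.adicCompletion F)) • 1) ((⅟(2 : v.adicCompletion F)) • 1))
            (Matrix.fromBlocks 0 0 (-1) (-1)) (Matrix.fromBlocks ((⅟(2 : v.adicCompletion F)) • 1) (-((⅟(2 : v.adicCompletion F)) • 1)) 0 0) :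
          Matrix ((Fin n ⊕ Fin n) ⊕ (Fin n ⊕ Fin n)) ((Fin n ⊕ Fin n) ⊕ (Fin n ⊕ Fin n)) (v.adicCompletion F)))
    (M : GL (Fin (n + n)) (v.adicCompletion F))
    (hMinv : ((M⁻¹ : GL (Fin (n + n)) (v.adicCompletion F)) : Matrix (Fin (n + n)) (Fin (n + n)) (v.adicCompletion F)) =
      Matrix.reindex (e₂ n) (e₂ n) (Matrix.fromBlocks ((2 : v.adicCompletion F) • 1) 0 0 (localGram F n T₀ v)))
    (x : Fin (n + n) → v.adicCompletion F) :
    ((transportSp (localGram F (n + n) (LocalSplitting.gramD F n T₀) v) hTv (levi M * K) : LocalSp F (n + n) (LocalSplitting.gramD F n T₀) v) :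
        ((Fin (n + n) → v.adicCompletion F) × (Fin (n + n) → v.adicCompletion F)) ≃ₗ[v.adicCompletion F]
          ((Fin (n + n) → v.adicCompletion F) × (Fin (n + n) → v.adicCompletion F))).symm (x, 0) =
      ((Sum.elim (fun i => x (e₂ n (Sum.inl i))) (fun i => -x (e₂ n (Sum.inl i)))) ∘ (e₂ n).symm,
        (Sum.elim (fun i => x (e₂ n (Sum.inr i))) (fun i => -x (e₂ n (Sum.inr i)))) ∘ (e₂ n).symm) := by
  rw [LinearEquiv.symm_apply_eq]
  exact (transportSp_levi_mul_cayley_apply_antidiag F v n hTv K hK M hMinv x).symm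

/-! ## §3 The reading through the normalised mover is plain `(re, im)` -/

section Reading

variable (E : Type) [Field E] [NumberField E] [Algebra F E] [Algebra.IsQuadraticExtension F E]
  (c : E ≃ₐ[F] E) {δ : E} (hcδ : c δ = -δ) (hδ : δ ≠ 0) {d : F} (hd : δ * δ = algebraMap F E d)

/-- **THE NORMALISED READING**: through the normalised mover, the `E ⊗ F_v`-coordinates of the point `(x, 0) ∈ X` are PLAIN quadratic coordinates —
`halfDiff (e_D⁻¹ ((transportSp 𝕋 (m(M)·κ))⁻¹ (x, 0))) i = ι_v(x (e₂ (inl i))) + ι_v(x (e₂ (inr i))) · δ̂` (no `½`, no `T₀`: the weights of the bare Cayley pair,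
block-D desk FLAG 4, are absorbed by `M`). [cite: HarrisKudlaSweet1996, §1 (1.11)] [cite: Kudla1994, §3] -/
theorem halfDiff_eD_symm_normalisedMover_symm_apply [Invertible (2 : v.adicCompletion F)]
    (hTv : IsUnit (localGram F (n + n) (LocalSplitting.gramD F n T₀) v).det)
    (K : Matrix.symplecticGroup (Fin (n + n)) (v.adicCompletion F))
    (hK : (K : Matrix (Fin (n + n) ⊕ Fin (n + n)) (Fin (n + n) ⊕ Fin (n + n)) (v.adicCompletion F)) =
      Matrix.reindex ((e₂ n).sumCongr (e₂ n)) ((e₂ n).sumCongr (e₂ n))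
        (Matrix.fromBlocks (Matrix.fromBlocks 1 (-1) 0 0)
            (Matrix.fromBlocks 0 0 ((⅟(2 : v.adicCompletion F)) • 1) ((⅟(2 : v.adicCompletion F)) • 1))
            (Matrix.fromBlocks 0 0 (-1) (-1)) (Matrix.fromBlocks ((⅟(2 : v.adicCompletion F)) • 1) (-((⅟(2 : v.adicCompletion F)) • 1)) 0 0) :
          Matrix ((Fin n ⊕ Fin n) ⊕ (Fin n ⊕ Fin n)) ((Fin n ⊕ Fin n) ⊕ (Fin n ⊕ Fin n)) (v.adicCompletion F)))
    (M : GL (Fin (n + n)) (v.adicCompletion F))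
    (hMinv : ((M⁻¹ : GL (Fin (n + n)) (v.adicCompletion F)) : Matrix (Fin (n + n)) (Fin (n + n)) (v.adicCompletion F)) =
      Matrix.reindex (e₂ n) (e₂ n) (Matrix.fromBlocks ((2 : v.adicCompletion F) • 1) 0 0 (localGram F n T₀ v)))
    (x : Fin (n + n) → v.adicCompletion F) (i : Fin n) :
    halfDiff ((eD F E c hcδ hδ hd v n).symm
        (((transportSp (localGram F (n + n) (LocalSplitting.gramD F n T₀) v) hTv (levi M * K) : LocalSp F (n + n) (LocalSplitting.gramD F n T₀) v) :
          ((Fin (n + n) → v.adicCompletion F) × (Fin (n + n) → v.adicCompletion F)) ≃ₗ[v.adicCompletion F]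
            ((Fin (n + n) → v.adicCompletion F) × (Fin (n + n) → v.adicCompletion F))).symm (x, 0))) i =
      UnitaryGroup.toLocalRing E v (x (e₂ n (Sum.inl i))) + UnitaryGroup.toLocalRing E v (x (e₂ n (Sum.inr i))) * algebraMap E (LocalRing E v) δ := by
  rw [transportSp_levi_mul_cayley_symm_apply F v n hTv K hK M hMinv x,
    K2LiuTensorMiddleCellPointReading.halfDiff_eD_symm_apply F E c hcδ hδ hd v n]
  simp only [Function.comp_apply, Equiv.symm_apply_apply, Sum.elim_inl, Sum.elim_inr, map_neg, sub_neg_eq_add]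
  have key : ∀ a b : LocalRing E v, ⅟(2 : LocalRing E v) * ((a + a) + (b + b) * algebraMap E (LocalRing E v) δ) =
      a + b * algebraMap E (LocalRing E v) δ := by
    intro a b
    rw [← two_mul, ← two_mul, mul_assoc, ← mul_add, ← mul_assoc, invOf_mul_self, one_mul]
  exact key _ _

/-- **THE NORMALISED MOVER READING `ĉX`** of ★ (C3-c) `exists_moverReading` ∕ `exists_pointReading`: if `cX x = halfDiff (e_D⁻¹ (â⁻¹ (x, 0)))` for the
normalised mover `â = transportSp 𝕋 (m(M)·κ)`, then `cX x i = ι_v(x_{inl i}) + ι_v(x_{inr i})·δ̂` — block-D desk FLAG 4 ∕ desk WORD #56 «(N)»: the implementer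
pins of record are the NORMALISED Cayley pair, in which the cone variable's `E_w`-reading is plain `(re, im)` along `e₂`. [cite: HarrisKudlaSweet1996, §1 (1.11)] -/
theorem moverReading_eq_of_normalised [Invertible (2 : v.adicCompletion F)]
    (hTv : IsUnit (localGram F (n + n) (LocalSplitting.gramD F n T₀) v).det)
    (K : Matrix.symplecticGroup (Fin (n + n)) (v.adicCompletion F))
    (hK : (K : Matrix (Fin (n + n) ⊕ Fin (n + n)) (Fin (n + n) ⊕ Fin (n + n)) (v.adicCompletion F)) =
      Matrix.reindex ((e₂ n).sumCongr (e₂ n)) ((e₂ n).sumCongr (e₂ n))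
        (Matrix.fromBlocks (Matrix.fromBlocks 1 (-1) 0 0)
            (Matrix.fromBlocks 0 0 ((⅟(2 : v.adicCompletion F)) • 1) ((⅟(2 : v.adicCompletion F)) • 1))
            (Matrix.fromBlocks 0 0 (-1) (-1)) (Matrix.fromBlocks ((⅟(2 : v.adicCompletion F)) • 1) (-((⅟(2 : v.adicCompletion F)) • 1)) 0 0) :
          Matrix ((Fin n ⊕ Fin n) ⊕ (Fin n ⊕ Fin n)) ((Fin n ⊕ Fin n) ⊕ (Fin n ⊕ Fin n)) (v.adicCompletion F)))
    (M : GL (Fin (n + n)) (v.adicCompletion F))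
    (hMinv : ((M⁻¹ : GL (Fin (n + n)) (v.adicCompletion F)) : Matrix (Fin (n + n)) (Fin (n + n)) (v.adicCompletion F)) =
      Matrix.reindex (e₂ n) (e₂ n) (Matrix.fromBlocks ((2 : v.adicCompletion F) • 1) 0 0 (localGram F n T₀ v)))
    (cX : (Fin (n + n) → v.adicCompletion F) → (Fin n → LocalRing E v))
    (hcX : ∀ x : Fin (n + n) → v.adicCompletion F,
      cX x = halfDiff ((eD F E c hcδ hδ hd v n).symm
        (((transportSp (localGram F (n + n) (LocalSplitting.gramD F n T₀) v) hTv (levi M * K) : LocalSp F (n + n) (LocalSplitting.gramD F n T₀) v) :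
          ((Fin (n + n) → v.adicCompletion F) × (Fin (n + n) → v.adicCompletion F)) ≃ₗ[v.adicCompletion F]
            ((Fin (n + n) → v.adicCompletion F) × (Fin (n + n) → v.adicCompletion F))).symm (x, 0))))
    (x : Fin (n + n) → v.adicCompletion F) (i : Fin n) :
    cX x i = UnitaryGroup.toLocalRing E v (x (e₂ n (Sum.inl i))) + UnitaryGroup.toLocalRing E v (x (e₂ n (Sum.inr i))) * algebraMap E (LocalRing E v) δ := by
  rw [hcX]
  exact halfDiff_eD_symm_normalisedMover_symm_apply F v n E c hcδ hδ hd hTv K hK M hMinv x i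

end Reading

end Summit.HodgeConjecture.HodgeConjecture.Cruxes.HLiu418.K2LiuNormalisedCayleyReading

end
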